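/-
Copyright (c) 2026 the pub-hodgecm-mathlib formalisation cell (harness21).  Prover seat hodgecm-mathlib-B-p14 (g30), (F11) «ramified torus `(EL)¹ × E¹`» of
MAP v3 (architect A-p06 (g26)); LEAD F0P3a-plan (g9) WORDS T8-41, T8-45 (`stub_countIrredClause`), 2026-09-01.
-/
import Literature.NumberTheory.Rogawski1990.LocalStableClassesNonsplitTypeTwoNorms   -- ★ (N2) `exists_eq_hermStar_mul_self_of_det_norm` (this seat)
import Literature.NumberTheory.Rogawski1990.LocalStableClassesNonsplit             -- ★ FILE 1 (B-p04): `conjClassesIn`, Cartan calculus (`CartanRealisation` ∕ `CartanAlgebra`)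
import Literature.NumberTheory.Rogawski1990.LocalTransfer                          -- ★ `IsStablyConjH`, `IsLocalStablyConjH`, `stableOrbitalIntegralRel`
import Literature.LinearAlgebra.Matrix.BlockCentralizerDisjointSpectra             -- ★ `exists_eq_smul_one_add_smul_of_commute`, `eval_charpoly_ne_zero_of_irreducible`
import HarnessLib

/-!
# ONE class in the stable class of an elliptic element of `U(1,1)` generating a FIELD over `E_w` — the `H`-side class set of Flicker's torus
# `T_H ≃ (EL)¹ × E¹` (Flicker 1998 p. 97: «the stable conjugacy class of `t` in `H` consists of a single conjugacy class»; Rogawski 1990 §3.5–3.6)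

Topic `NumberTheory/Rogawski1990`; namespace `Literature.NumberTheory.Rogawski1990`.  THEOREMS ONLY (no definition, no instance, no notation, no named fact,
no `sorry`).  Cell `pub/hodgecm-mathlib`, crux H413 = `stmt-HodgeConjecture-24833`, P3a road «D-N7-inert», MAP v3 brick **(F11)** (the ramified torus; line
«N7nsCount» stub `stub_countIrredClause`), sub-brick (F11-a): the `H = U(1,1) × U(1)`-SIDE CLASS SET.  Companion of ★ `LocalStableClassesNonsplitTypeTwoCount`
(this seat: in `U(2,1)` the same element has TWO classes) and of ★ `LocalStableClassesNonsplitRankTwo` (A-p13 (g30): the type-(1) rank-2 case, two classes).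

THE MATHEMATICS.  `E∕F` a quadratic extension of number fields, `v` a finite place of `F` NOT split in `E` (`E_v = E ⊗_F F_v` a field, `σ` its conjugation),
`H ∈ M₂(E_v)` hermitian with unit determinant, `γ ∈ U(H)(F_v) ⊂ GL₂(E_v)` with IRREDUCIBLE characteristic polynomial over `E_v` (so `E_v[γ] ≅ E_vL_w` is a
quadratic field over `E_v` — at `p ≠ 2` with `E_v∕F_v` unramified this is `L_w∕F_v` RAMIFIED, Flicker's `(EL)¹ ⊂ U(1,1)`).  CLAIM (§2): every `δ′ ∈ U(H)(F_v)`
stably conjugate (`GL₂(E_v)`-conjugate) to `γ` is `U(H)(F_v)`-conjugate to it — `conjClassesIn σ H γ = {⟦γ⟧}`, `ncard = 1`.  PROOF (Rogawski's Cartan calculus,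
§3.5): for `g γ g⁻¹ = δ′` the Cartan class `x = H⁻¹ H_g` commutes with `γ`, so `x = α + βγ ∈ E_v[γ]` (★ `exists_eq_smul_one_add_smul_of_commute`), is
`⋆`-symmetric (★ `hermStar_inv_mul_twistGram`) and has `det x = σ(det g) det g` a NORM (★ `det_inv_mul_twistGram`); by (N2) ★ `exists_eq_hermStar_mul_self_of_det_norm`
(the regular quadratic extension `E_v[γ]^⋆ ∕ F_v`, ★ `HilbertSymbolRegularQuadraticExtension`) `x = S⋆ S` with `S ∈ E_v[γ]^×`, and ★ R6a
`exists_unitary_conj_of_inv_mul_twistGram_eq` turns `S` into a unitary conjugator.  (Cohomologically: `ker[H¹(F_v, Res_{L_w∕F_v}(EL)¹) → H¹(F_v, U(1,1))] =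
ker[L_w^×∕N(EL_w^×) → F_v^×∕N(E_v^×)] = 1`; no cohomology is used here.)  §3 lifts it to `H = U(H) × U(J₁)` (rank one: stable conjugacy is equality) and §4 reads
it on the CM carriers `H_v = U(Φ₂)(L⁺_v) × U(Φ₁)(L⁺_v)`: **`Φ^st(γ_H, f) = Φ(⟦γ_H⟧, f)`** for every `f` and every orbital-measure family — the structural half of
Flicker's `Φ^st_{1_{K_H}}(t) = Φ_H(t)` (p. 97); the VALUE `(q^{N+1} − 1)∕(q − 1)` is (F9)'s lattice count (B-p10 (g24)), not this file.
HONEST LABEL: HC_CM is proved only modulo the printed citations until rung 0 closes; nothing printed is paid here.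

## References
* [Rogawski1990] J. D. Rogawski, *Automorphic Representations of Unitary Groups in Three Variables*, Ann. of Math. Stud. 123 (1990): §3.1 p. 19, §3.5 Prop. 3.5.2
  (a)(c) p. 29, §3.6 p. 31 (tori `T_K × E¹`), §4.1 (4.1.1) p. 39.
* [Flicker1998UnitaryFL] Y. Z. Flicker, *Elementary proof of the fundamental lemma for a unitary group*, Canad. J. Math. 50 (1998), Prop. 3 p. 78 (`T_H ⊂ H`), p. 97.
* [Kottwitz1986] R. E. Kottwitz, *Stable trace formula: elliptic singular terms*, Math. Ann. 275 (1986), §7.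
-/

set_option autoImplicit false

open NumberField IsDedekindDomain Matrix
open scoped MatrixGroups

namespace Literature.NumberTheory.Rogawski1990

open Literature.NumberTheory.Automorphic Literature.NumberTheory.Automorphic.UnitaryGroup Literature.NumberTheory.QuadraticForms
open Literature.AlgebraicGeometry.ShimuraVarieties (unitaryGroup mem_unitaryGroup_iff)
open Literature.LinearAlgebra.Matrix (eval_charpoly_ne_zero_of_irreducible exists_eq_smul_one_add_smul_of_commute commute_smul_one_add_smul)

/-! ## §1 Generic: a one-class stable class -/

section Generic

variable {A : Type*} [Group A]

/-- **The set of conjugacy classes in a ONE-class stable class is `{⟦a⟧}`.** [cite: Rogawski1990, §4.1 (4.1.1) p. 39] -/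
theorem setOf_st_out_eq_singleton (st : A → A → Prop) (a : A) (hrefl : ∀ b : A, IsConj a b → st a b) (hall : ∀ k, st a k → IsConj a k) :
    {c : ConjClasses A | st a (Quotient.out c)} = {ConjClasses.mk a} := by
  ext c
  simp only [Set.mem_setOf_eq, Set.mem_singleton_iff]
  constructor
  · intro h
    exact (Quotient.out_eq c).symm.trans (ConjClasses.mk_eq_mk_iff_isConj.2 (hall _ h).symm)
  · rintro rfl
    exact hrefl _ (ConjClasses.mk_eq_mk_iff_isConj.1 (Quotient.out_eq (ConjClasses.mk a)).symm)

/-- **`Φ^st(a, f) = Φ(⟦a⟧, f)` when the stable class of `a` is the single conjugacy class of `a`** (any `f`, any orbital measure family).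
[cite: Rogawski1990, §4.1 (4.1.1) p. 39] [cite: Flicker1998UnitaryFL, p. 97] -/
theorem stableOrbitalIntegralRel_eq_classOrbitalIntegral_of_forall_isConj [∀ b : A, MeasurableSpace (A ⧸ Subgroup.centralizer ({b} : Set A))]
    (st : A → A → Prop) (m : OrbitalMeasureFamily A) (f : A → ℂ) (a : A) (hrefl : ∀ b : A, IsConj a b → st a b) (hall : ∀ k, st a k → IsConj a k) :
    stableOrbitalIntegralRel st m f a = classOrbitalIntegral m f (ConjClasses.mk a) := by
  rw [stableOrbitalIntegralRel_def, setOf_st_out_eq_singleton st a hrefl hall]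
  exact finsum_mem_singleton

variable {K : Type*} [Field K] (σ : K →+* K)

/-- Conjugacy in the subgroup `U(H)(K)` unfolded to the ambient `GL_n`. [cite: Rogawski1990, §3.1 p. 19] -/
private theorem isConj_iff_exists_mem_rk2 {n : Type*} [Fintype n] [DecidableEq n] {H : Matrix n n K} (γ δ : unitaryGroup σ H) :
    IsConj γ δ ↔ ∃ u : GL n K, u ∈ unitaryGroup σ H ∧ u * γ.val * u⁻¹ = δ.val := by
  rw [isConj_iff]
  constructor
  · rintro ⟨c, hc⟩
    exact ⟨c.val, c.2, congrArg Subtype.val hc⟩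
  · rintro ⟨u, hu, h⟩
    exact ⟨⟨u, hu⟩, Subtype.ext h⟩

/-- In RANK ONE stable conjugacy is equality (`1 × 1` invertible matrices commute). [cite: Rogawski1990, §3.1 p. 19] -/
private theorem eq_of_isStablyConj_fin_one_rk2 {R : Type*} [CommRing R] (τ : R →+* R) (J₁ : Matrix (Fin 1) (Fin 1) R) {a b : unitaryGroup τ J₁}
    (h : IsStablyConj τ J₁ a b) : a = b := by
  obtain ⟨c, hc⟩ := isConj_iff.1 h
  apply Subtype.ext
  rw [← hc]
  have hcomm : (c : GL (Fin 1) R) * (a : GL (Fin 1) R) = (a : GL (Fin 1) R) * c := by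
    refine Units.ext (Matrix.ext fun i j => ?_)
    fin_cases i; fin_cases j
    simp [Units.val_mul, Matrix.mul_apply, mul_comm]
  rw [hcomm, mul_inv_cancel_right]

end Generic

/-! ## §2 Rank 2, irreducible characteristic polynomial, non-split `v`: every stable conjugate is conjugate -/

section Local

variable {F : Type} (E : Type) [Field F] [NumberField F] [Field E] [NumberField E] [Algebra F E]
  [Algebra.IsQuadraticExtension F E] (v : HeightOneSpectrum (𝓞 F)) (c : E ≃ₐ[F] E) {δ : E} (hcδ : c δ = -δ) (hδ : δ ≠ 0)
variable {H : Matrix (Fin 2) (Fin 2) (LocalRing E v)} {γ : GL (Fin 2) (LocalRing E v)}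

include hcδ hδ in
/-- `δ² ∈ F` (`δ` is `c`-anti-invariant in the quadratic extension `E∕F`). [folklore] -/
private theorem exists_delta_mul_self_eq_algebraMap_rk2 : ∃ d : F, δ * δ = algebraMap F E d := by
  obtain ⟨x, y, hxy⟩ := exists_eq_add_mul_of_isQuadraticExtension (F := F) (E := E) (not_mem_range_algebraMap_of_apply_eq_neg E c hcδ hδ) (δ * δ)
  have hc2 : c (δ * δ) = δ * δ := by rw [map_mul, hcδ, neg_mul_neg]
  have hy : algebraMap F E y * δ = 0 := by
    have h1 : c (δ * δ) = algebraMap F E x - algebraMap F E y * δ := by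
      rw [hxy, map_add, map_mul, AlgEquiv.commutes, AlgEquiv.commutes, hcδ, mul_neg, sub_eq_add_neg]
    rw [hc2, hxy] at h1
    have h2 : (2 : E) * (algebraMap F E y * δ) = 0 := by linear_combination h1
    exact (mul_eq_zero.1 h2).resolve_left two_ne_zero
  exact ⟨x, by rw [hxy, hy, add_zero]⟩

include hcδ hδ in
/-- **EVERY STABLE CONJUGATE IS CONJUGATE (rank 2, `χ_γ` irreducible, non-split `v`).**  For `H ∈ M₂(E_v)` hermitian with unit determinant and `γ ∈ U(H)(F_v)` whose
characteristic polynomial is IRREDUCIBLE over `E_v` (Flicker's elliptic `(EL)¹ ⊂ U(1,1)`, Rogawski's `T_K` in rank 2): every `δ′ ∈ U(H)(F_v)` stably conjugate to `γ`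
is `U(H)(F_v)`-conjugate to `γ`.  (Cartan class `x = H⁻¹H_g = α + βγ`, `⋆`-symmetric, `det x = N(det g)`; (N2) writes `x = S⋆S` in `E_v[γ]`; R6a.)
[cite: Rogawski1990, §3.5 Prop. 3.5.2 (a)(c) p. 29; §3.6 p. 31] [cite: Flicker1998UnitaryFL, p. 97] [cite: Kottwitz1986, §7] -/
theorem isConj_of_isStablyConj_of_irreducible_rankTwo (w : PlacesOver E v) (hw : c • w.1 = w.1) (hH : (H.map (conjLocal E c v))ᵀ = H) (hHd : IsUnit H.det)
    (hγ : γ ∈ unitaryGroup (conjLocal E c v) H) (hA : Irreducible γ.val.charpoly) (δ' : unitaryGroup (conjLocal E c v) H)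
    (hst : IsStablyConj (conjLocal E c v) H ⟨γ, hγ⟩ δ') : IsConj (⟨γ, hγ⟩ : unitaryGroup (conjLocal E c v) H) δ' := by
  -- (the membership and the stable conjugator are read BEFORE the local `Field` instance — elaboration hygiene)
  have hAu := (mem_unitaryGroup_iff (σ := conjLocal E c v) (H := H) (g := γ)).mp hγ
  obtain ⟨g, hg'⟩ := isStablyConj_iff.1 hst
  letI : Field (LocalRing E v) := (Liu2021.LemD1IndexedNonVacuityNonsplitPlace.isField_localRing_of_nonsplit E v c hcδ hδ w hw).toField
  have hσσ : ∀ x : LocalRing E v, conjLocal E c v (conjLocal E c v x) = x := Liu2021.LemD1OfPlace.conjLocal_conjLocal_apply E v c hcδ hδ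
  obtain ⟨d, hd⟩ := exists_delta_mul_self_eq_algebraMap_rk2 E c hcδ hδ
  have hA' : ∀ r : LocalRing E v, γ.val.charpoly.eval r ≠ 0 := eval_charpoly_ne_zero_of_irreducible hA (by simp)
  -- the Cartan class `x = H⁻¹ H_g ∈ E_v[γ]`
  have hxγ : Commute (H⁻¹ * twistGram (conjLocal E c v) H g.val) γ.val :=
    commute_inv_mul_twistGram (conjLocal E c v) H hHd (γ := ⟨γ, hγ⟩) (δ := δ') hg'
  obtain ⟨α, β, hx⟩ := exists_eq_smul_one_add_smul_of_commute hA hxγ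
  have hxs : hermStar (conjLocal E c v) H (α • (1 : Matrix (Fin 2) (Fin 2) (LocalRing E v)) + β • γ.val) = α • 1 + β • γ.val := by
    rw [← hx]; exact hermStar_inv_mul_twistGram (conjLocal E c v) H hHd hσσ hH g.val
  have hgd : IsUnit g.val.det := by have h := g.isUnit; rwa [Matrix.isUnit_iff_isUnit_det] at h
  have hxdet : ∃ z : LocalRing E v, IsUnit z ∧ (α • (1 : Matrix (Fin 2) (Fin 2) (LocalRing E v)) + β • γ.val).det = conjLocal E c v z * z :=
    ⟨g.val.det, hgd, by rw [← hx, det_inv_mul_twistGram (conjLocal E c v) H hHd]⟩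
  -- (N2): `x = S⋆ S` with `S = α′ + β′γ ∈ E_v[γ]^×`
  obtain ⟨α', β', hSu, hxS⟩ := exists_eq_hermStar_mul_self_of_det_norm E v c hcδ hδ hd w hw hH hHd hAu hA' hxs hxdet
  set S : Matrix (Fin 2) (Fin 2) (LocalRing E v) := α' • 1 + β' • γ.val with hSdef
  -- `S` as an element of `GL₂` commuting with `γ`
  obtain ⟨T, hTval, hTγ⟩ : ∃ T : GL (Fin 2) (LocalRing E v), T.val = S ∧ T * γ = γ * T := by
    refine ⟨Matrix.GeneralLinearGroup.mkOfDetNeZero S hSu.ne_zero, rfl, Units.ext ?_⟩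
    exact (commute_smul_one_add_smul γ.val α' β').eq
  have h1 : H⁻¹ * twistGram (conjLocal E c v) H g.val =
      hermStar (conjLocal E c v) H T.val * (H⁻¹ * twistGram (conjLocal E c v) H (1 : GL (Fin 2) (LocalRing E v)).val) * T.val := by
    rw [Units.val_one, twistGram_one, Matrix.nonsing_inv_mul H hHd, Matrix.mul_one, hTval, hx, hxS]
  obtain ⟨uu, huu, huc⟩ := exists_unitary_conj_of_inv_mul_twistGram_eq (conjLocal E c v) H hHd (γ := γ) (δ := γ) (g := 1)
    (by rw [one_mul, inv_one, mul_one]) hg' hTγ h1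
  exact ((isConj_iff_exists_mem_rk2 (conjLocal E c v) δ' ⟨γ, hγ⟩).2 ⟨uu, huu, huc⟩).symm

include hcδ hδ in
/-- **THE LOCAL CLASS SET OF THE RANK-2 ELLIPTIC TORUS `(EL)¹ ⊂ U(1,1)` IS A SINGLETON**: `conjClassesIn σ H γ = {⟦γ⟧}` for `γ ∈ U(H)(F_v)`, `H ∈ M₂(E_v)`, `χ_γ`
irreducible, `v` non-split.  [cite: Rogawski1990, §3.5 Prop. 3.5.2 (c) p. 29; §3.6 p. 31; §4.1 (4.1.1) p. 39] [cite: Flicker1998UnitaryFL, p. 97] -/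
theorem conjClassesIn_eq_singleton_of_irreducible_rankTwo (w : PlacesOver E v) (hw : c • w.1 = w.1) (hH : (H.map (conjLocal E c v))ᵀ = H) (hHd : IsUnit H.det)
    (hγ : γ ∈ unitaryGroup (conjLocal E c v) H) (hA : Irreducible γ.val.charpoly) :
    conjClassesIn (conjLocal E c v) H ⟨γ, hγ⟩ = {ConjClasses.mk ⟨γ, hγ⟩} := by
  ext x
  obtain ⟨δ', rfl⟩ := ConjClasses.mk_surjective x
  rw [mk_mem_conjClassesIn_iff, Set.mem_singleton_iff, ConjClasses.mk_eq_mk_iff_isConj]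
  exact ⟨fun h => (isConj_of_isStablyConj_of_irreducible_rankTwo E v c hcδ hδ w hw hH hHd hγ hA δ' h).symm,
    fun h => isStablyConj_of_isConj h.symm⟩

include hcδ hδ in
/-- **`#(conjClassesIn σ H γ) = 1`** in rank 2 for `χ_γ` irreducible at a non-split `v` — versus `2` in rank 3 (★ `ncard_conjClassesIn_eq_two`, the same eigen-data with
a `U(1)`-corner) and `2` in rank 2 for the split torus (★ `ncard_conjClassesIn_eq_two_rankTwo`).  [cite: Rogawski1990, §3.5 Prop. 3.5.2 (c) p. 29; §3.6 p. 31]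
[cite: Flicker1998UnitaryFL, p. 97] -/
theorem ncard_conjClassesIn_eq_one_of_irreducible_rankTwo (w : PlacesOver E v) (hw : c • w.1 = w.1) (hH : (H.map (conjLocal E c v))ᵀ = H) (hHd : IsUnit H.det)
    (hγ : γ ∈ unitaryGroup (conjLocal E c v) H) (hA : Irreducible γ.val.charpoly) :
    (conjClassesIn (conjLocal E c v) H ⟨γ, hγ⟩).ncard = 1 := by
  rw [conjClassesIn_eq_singleton_of_irreducible_rankTwo E v c hcδ hδ w hw hH hHd hγ hA, Set.ncard_singleton]

/-! ## §3 `H = U(H) × U(J₁)`: the one-class datum lifts (rank one: stable conjugacy is equality) -/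

include hcδ hδ in
/-- **On `U(H)(F_v) × U(J₁)(F_v)` every `IsStablyConjH`-conjugate of `(γ, γ₁)` is conjugate to it** (`χ_γ` irreducible, rank-2 factor §2; rank-1 factor: equality).
[cite: Rogawski1990, §3.1 p. 19; §3.6 p. 31] [cite: Flicker1998UnitaryFL, Prop. 3 p. 78; p. 97] -/
theorem isConj_of_isStablyConjH_of_irreducible (w : PlacesOver E v) (hw : c • w.1 = w.1) (hH : (H.map (conjLocal E c v))ᵀ = H) (hHd : IsUnit H.det)
    (hγ : γ ∈ unitaryGroup (conjLocal E c v) H) (hA : Irreducible γ.val.charpoly) (J₁ : Matrix (Fin 1) (Fin 1) (LocalRing E v))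
    (γ₁ : unitaryGroup (conjLocal E c v) J₁) (k : unitaryGroup (conjLocal E c v) H × unitaryGroup (conjLocal E c v) J₁)
    (hk : IsStablyConjH (conjLocal E c v) H J₁ (⟨γ, hγ⟩, γ₁) k) : IsConj ((⟨γ, hγ⟩ : unitaryGroup (conjLocal E c v) H), γ₁) k := by
  have h2 : γ₁ = k.2 := eq_of_isStablyConj_fin_one_rk2 (conjLocal E c v) J₁ hk.2
  obtain ⟨u, hu⟩ := isConj_iff.1 (isConj_of_isStablyConj_of_irreducible_rankTwo E v c hcδ hδ w hw hH hHd hγ hA k.1 hk.1)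
  exact isConj_iff.2 ⟨(u, 1), Prod.ext (by simpa using hu) (by simpa using h2)⟩

end Local

/-! ## §4 On the CM carriers `H_v = U(Φ₂)(L⁺_v) × U(Φ₁)(L⁺_v)`: `Φ^st(γ_H, f) = Φ(⟦γ_H⟧, f)` -/

section CM

variable (L : Type) [Field L] [NumberField L] [IsCMField L] (v : HeightOneSpectrum (𝓞 ↥(maximalRealSubfield L)))
  [∀ a : (UnitaryGroup.cmDatum L 2 (Matrix.of fun i j : Fin 2 => if i.val + j.val + 1 = 2 then (1 : L) else 0)).Local v ×
      (UnitaryGroup.cmDatum L 1 (Matrix.of fun i j : Fin 1 => if i.val + j.val + 1 = 1 then (1 : L) else 0)).Local v,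
    MeasurableSpace (((UnitaryGroup.cmDatum L 2 (Matrix.of fun i j : Fin 2 => if i.val + j.val + 1 = 2 then (1 : L) else 0)).Local v ×
      (UnitaryGroup.cmDatum L 1 (Matrix.of fun i j : Fin 1 => if i.val + j.val + 1 = 1 then (1 : L) else 0)).Local v) ⧸
      Subgroup.centralizer ({a} : Set ((UnitaryGroup.cmDatum L 2 (Matrix.of fun i j : Fin 2 => if i.val + j.val + 1 = 2 then (1 : L) else 0)).Local v ×
      (UnitaryGroup.cmDatum L 1 (Matrix.of fun i j : Fin 1 => if i.val + j.val + 1 = 1 then (1 : L) else 0)).Local v)))]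

/-- A CM field has a non-zero element negated by complex conjugation. [cite: Rogawski1990, §1.10] -/
private theorem exists_complexConj_eq_neg_ne_zero_rk2 : ∃ δ : L, IsCMField.complexConj L δ = -δ ∧ δ ≠ 0 := by
  obtain ⟨ζ, hζ⟩ := not_forall.1 fun h0 => IsCMField.complexConj_ne_one L (AlgEquiv.ext h0)
  refine ⟨ζ - IsCMField.complexConj L ζ, by rw [map_sub, IsCMField.complexConj_apply_apply, neg_sub], fun h0 => hζ ?_⟩
  rw [sub_eq_zero] at h0
  exact h0.symm

/-- **`Φ^st(γ_H, f) = Φ(⟦γ_H⟧, f)` ON `H_v` FOR FLICKER'S TORUS `T_H ≃ (EL)¹ × E¹`** (CM carriers, non-split finite `v`, `Φ₂ := adelicForm ↦ local` hermitian with unit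
determinant at `v`): if the `U(Φ₂)`-component `γ₂` of `γ_H = (γ₂, γ₁)` has IRREDUCIBLE characteristic polynomial over `L_v = L ⊗ L⁺_v`, the stable class of `γ_H` in
`H_v` is the single class `⟦γ_H⟧`, so the stable orbital integral of ANY `f` for ANY orbital-measure family is the class orbital integral — the structural half of
«`Φ^st_{1_{K_H}}(t) = Φ_H(t)`» (the value is (F9)'s count).  [cite: Flicker1998UnitaryFL, p. 97] [cite: Rogawski1990, §4.1 (4.1.1) p. 39; §3.6 p. 31] -/
theorem stableOrbitalIntegralRel_eq_classOrbitalIntegral_of_irreducible (w : UnitaryGroup.PlacesOver L v) (hw : IsCMField.complexConj L • w.1 = w.1)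
    (hΦ₂ : ((((UnitaryGroup.adelicForm L 2 (Matrix.of fun i j : Fin 2 => if i.val + j.val + 1 = 2 then (1 : L) else 0)).map (UnitaryGroup.adeleToLocal L v)).map
      (UnitaryGroup.conjLocal L (IsCMField.complexConj L) v))ᵀ =
        (UnitaryGroup.adelicForm L 2 (Matrix.of fun i j : Fin 2 => if i.val + j.val + 1 = 2 then (1 : L) else 0)).map (UnitaryGroup.adeleToLocal L v)))
    (hΦ₂d : IsUnit ((UnitaryGroup.adelicForm L 2 (Matrix.of fun i j : Fin 2 => if i.val + j.val + 1 = 2 then (1 : L) else 0)).map (UnitaryGroup.adeleToLocal L v)).det)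
    (mH : OrbitalMeasureFamily ((UnitaryGroup.cmDatum L 2 (Matrix.of fun i j : Fin 2 => if i.val + j.val + 1 = 2 then (1 : L) else 0)).Local v ×
      (UnitaryGroup.cmDatum L 1 (Matrix.of fun i j : Fin 1 => if i.val + j.val + 1 = 1 then (1 : L) else 0)).Local v))
    (fH : ((UnitaryGroup.cmDatum L 2 (Matrix.of fun i j : Fin 2 => if i.val + j.val + 1 = 2 then (1 : L) else 0)).Local v ×
      (UnitaryGroup.cmDatum L 1 (Matrix.of fun i j : Fin 1 => if i.val + j.val + 1 = 1 then (1 : L) else 0)).Local v) → ℂ)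
    (γH : (UnitaryGroup.cmDatum L 2 (Matrix.of fun i j : Fin 2 => if i.val + j.val + 1 = 2 then (1 : L) else 0)).Local v ×
      (UnitaryGroup.cmDatum L 1 (Matrix.of fun i j : Fin 1 => if i.val + j.val + 1 = 1 then (1 : L) else 0)).Local v)
    (hirr : Irreducible ((γH.1.val : GL (Fin 2) (UnitaryGroup.LocalRing L v)).val.charpoly)) :
    stableOrbitalIntegralRel (IsLocalStablyConjH L v) mH fH γH = classOrbitalIntegral mH fH (ConjClasses.mk γH) := by
  obtain ⟨δ, hcδ, hδ⟩ := exists_complexConj_eq_neg_ne_zero_rk2 L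
  refine stableOrbitalIntegralRel_eq_classOrbitalIntegral_of_forall_isConj (IsLocalStablyConjH L v) mH fH γH (fun _ h => isStablyConjH_of_isConj h) fun k hk => ?_
  have h := isConj_of_isStablyConjH_of_irreducible L v (IsCMField.complexConj L) hcδ hδ w hw hΦ₂ hΦ₂d γH.1.2 hirr _ γH.2 k hk
  exact h

end CM

end Literature.NumberTheory.Rogawski1990
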